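import Summits.QuantumFields.BalabanUV.T4Continuum.Support.ScalarBlockPoincareLocal
import Summits.QuantumFields.BalabanUV.T4Continuum.Support.VariationalCovariantScalarPair

/-!
# T⁴ programme, spine node NE2 (U1a), road P2 supplier items (O6)(b)+(c) — LEAF P⁺ LOCALISED: the covariant block Poincaré inequality
# with the frame hypothesis on IN-BLOCK bonds only, and then WITHOUT ANY FRAME (the frames are built from the data `T`): smallness per unit
# block, `C_P = 4` in place of `32d`

NE2 formalisation swarm, leaf prover 01 (gen 4), continuing (O6)(a) (`Support/ScalarBlockPoincareLocal`, the in-block Poincaré inequality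
`nsq (f − Π′f) ≤ ½·Σ_ν Σ_{in-block bonds} |∂_ν f|²`) along the road owner t4-ne2-p2-g11's plan (CLAIMS.log l.10301, items (b), (c)):
 * §1 `sum_inBlock_nsq_sdiff_frame_le` — STEP (i) of leaf P⁺ localised: the IN-BLOCK Dirichlet sum of the framed field `g = G·f` is
   `≤ 2n²·(dirR f + d·m_G²·nsq f)` when the frame defect `|G(x+e_μ) − G(x)R(x,μ)| ≤ m_G` is known ONLY on the bonds `(x, x+e_μ)` with both
   ends in one block (base-point form `x = n·y + j`, `j_μ + 1 < n`);
 * §2 **`nsq_le_covariant_poincare_local`** — leaf P⁺ (`VariationalCovariantPoincare.nsq_le_covariant_poincare`, owner gen 10) RE-RUN on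
   (O6)(a): `Σ|f|² ≤ 8·n^d·Σ_z|(Q_T f)(z)|² + 4·n²·Σ_{μ,x}|R(x,μ)f(x+e_μ) − f(x)|²` under the in-block frame hypothesis, the block hypothesis
   `|G(n·z+j) − c(z)T(n·z+j)| ≤ m_B` and the smallness `2d·(n·m_G)² + 4·m_B² ≤ ½` (was `16d²·(n·m_G)² + 4m_B² ≤ ½` with `32d` in place of `4`);
 * §3 **`nsq_le_covariant_poincare_of_inBlock`** — (O6)(c) THE FRAMES ARE CONSTRUCTIBLE FROM THE DATA: for UNIT site transports `T`
   take `G := T`, `c := 1`, `m_B := 0`, `m_G := w` = the in-block transport defect `|R(x,μ)·conj T(x+e_μ)·T(x) − 1| ≤ w` (leaf UB⁺'s binder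
   `hw`, `VariationalCovariantUpperBound.blockSpin_covariant_le`): `Σ|f|² ≤ 8·n^d·Σ|Q_T f|² + 4·n²·dirR f` provided `2d·(n·w)² ≤ ½` — NO frame,
   NO global small field; and the `blockOf`-phrased twin `…_of_blockOf`;
 * §4 the physical-units read-outs in the vocabulary of `VariationalCovariantScalarPair` (owner gen 10): **`qW_le_coarse_local`**
   (`qW f ≤ 8·nsq (Q_T f) + 4·Sc f ≤ 136·(Sc f + nsq (Q_T f))`) and **`qV_le_composite_local`** (one-step local P⁺ + level-`n` local P⁺ + FED⁺
   `sum_dirU_Qc_le` BY NAME: `qV f′ ≤ 136·(Sf f′ + nsq (Q_T (Q_{T′} f′)))` under the two in-block defects `2d(n·w)² ≤ ½`, `2d(L·w′)² ≤ ½` and the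
   mismatch absorption `64d·(n·m)² ≤ ½`) — the `hPc` ∕ `hPf` inputs of `pair_bracket(_sqrt)` with unit-modulus DATA and NO frames (constant
   `136` in place of `1088d + 128`); §3b∕§4 also give the RELATIVE forms (`…_rel`: a nested `T` read against a reference `T₀`, N-ne2p2g11-2).

HONEST FRAMING (T4-DAG p. 1).  Rung (B)+1 only — NOT infinite volume, NOT a mass gap, NOT Clay.  Node NE2 is NOT IN PRINT and NOT proved
here, on either road.  MODEL LEVEL: bond phases `R`, `R′` (`‖·‖ ≤ 1` where used), UNIT site transports `T`, `T′` are DATA; lattice units;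
scalar (0-form) sector; abelian.  Everything is OURS and elementary ([folklore] lattice calculus + (O6)(a) + the owner's STEP (ii)
`nsq_PiS_frame_le` and FED⁺ BY NAME); nothing printed is a hypothesis; no `def … : Prop`; no `sorry`.  HONEST DEPENDENCY: continuum YM on T⁴ ⇐
BetaPertH ∧ nine spine estimates (0/9 proved); BetaPertH ⇐ (D1) ∧ (D4) ∧ CAP+tail; G-an2-4 gates asym, D1 and NE2/3/4.
-/

noncomputable section

open scoped BigOperators ComplexConjugate Matrix
open Finset

namespace Summit.QuantumFields.BalabanUV.T4Continuum.VariationalCovariantPoincareLocal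

open Literature.MathematicalPhysics.QuantumFieldTheory.Balaban1983to89.B5Prop11Plancherel (Tor fine unitVec)
open Literature.MathematicalPhysics.QuantumFieldTheory.Balaban1983to89.B5Prop11Lower (nsq nsq_nonneg)
open Literature.MathematicalPhysics.QuantumFieldTheory.Balaban1983to89.B5Action121 (sdiff sdiff_mulVec)
open Literature.MathematicalPhysics.QuantumFieldTheory.Balaban1983to89.B5Block118 (bpt QsOp QsOp_mulVec)
open Literature.MathematicalPhysics.QuantumFieldTheory.Balaban1983to89.B5Blocks16 (blockOf blockOf_bpt)
open Literature.MathematicalPhysics.QuantumFieldTheory.Balaban1983to89.B5AverageCurlStokes (sum_translate sum_blocks_real)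
open Summit.QuantumFields.BalabanUV.T4Continuum.ScalarBlockPoincare (PiS nsq_add_le)
open Summit.QuantumFields.BalabanUV.T4Continuum.ScalarBlockPoincareLocal (nsq_sub_PiS_le_inBlock blockOf_bpt_add_unitVec)
open Summit.QuantumFields.BalabanUV.T4Continuum.VariationalCovariantPoincare (QT dirR nsq_frame_mul nsq_PiS_frame_le)
open Summit.QuantumFields.BalabanUV.T4Continuum.VariationalCovariantFederbush (dirU Qc mis sum_dirU_Qc_le dirU_nonneg)
open Summit.QuantumFields.BalabanUV.T4Continuum.VariationalCovariantScalarPair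
  (Sc Sf qW qV Qk Q1 Sc_nonneg Sf_nonneg arith_coarse arith_fine)

variable {d : ℕ} (n L : ℕ) [NeZero n] [NeZero L] (M : Fin d → ℕ) [hM : ∀ μ, NeZero (M μ)]

/-! ## §1 STEP (i) localised: the in-block Dirichlet sum of the framed field -/

omit [NeZero n] [NeZero L] hM in
/-- pointwise, at ONE bond where the frame defect is known: `‖g(x+e) − g(x)‖² ≤ 2·m_G²‖f(x+e)‖² + 2·‖R(x,ν)f(x+e) − f(x)‖²` (`g = G·f`, `|G| = 1`).
[folklore] -/
theorem norm_frame_diff_sq_le {R : Tor (fine n M) → Fin d → ℂ} {G : Tor (fine n M) → ℂ} (hG : ∀ x, ‖G x‖ = 1) {mG : ℝ}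
    (f : Tor (fine n M) → ℂ) {x : Tor (fine n M)} {ν : Fin d} (hx : ‖G (x + unitVec (fine n M) ν) - G x * R x ν‖ ≤ mG) :
    ‖G (x + unitVec (fine n M) ν) * f (x + unitVec (fine n M) ν) - G x * f x‖ ^ 2
      ≤ 2 * (mG ^ 2 * ‖f (x + unitVec (fine n M) ν)‖ ^ 2) + 2 * ‖R x ν * f (x + unitVec (fine n M) ν) - f x‖ ^ 2 := by
  have e : G (x + unitVec (fine n M) ν) * f (x + unitVec (fine n M) ν) - G x * f x
      = (G (x + unitVec (fine n M) ν) - G x * R x ν) * f (x + unitVec (fine n M) ν)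
        + G x * (R x ν * f (x + unitVec (fine n M) ν) - f x) := by ring
  have h1 : ‖G (x + unitVec (fine n M) ν) * f (x + unitVec (fine n M) ν) - G x * f x‖
      ≤ mG * ‖f (x + unitVec (fine n M) ν)‖ + ‖R x ν * f (x + unitVec (fine n M) ν) - f x‖ := by
    rw [e]
    refine (norm_add_le _ _).trans (add_le_add ?_ ?_)
    · rw [norm_mul]; exact mul_le_mul_of_nonneg_right hx (norm_nonneg _)
    · rw [norm_mul, hG, one_mul]
  have h2 := pow_le_pow_left₀ (norm_nonneg _) h1 2
  refine h2.trans ?_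
  rw [← mul_pow]
  nlinarith [sq_nonneg (mG * ‖f (x + unitVec (fine n M) ν)‖ - ‖R x ν * f (x + unitVec (fine n M) ν) - f x‖)]

omit [NeZero L] in
/-- **STEP (i) LOCALISED**: with the frame defect `|G(x+e_μ) − G(x)R(x,μ)| ≤ m_G` known ONLY on the in-block bonds (`x = n·y + j`, `j_μ + 1 < n`),
the in-block Dirichlet sum of `g = G·f` obeys `Σ_ν Σ_y Σ_{j_ν+1<n} |(∂_ν g)(n·y + j)|² ≤ 2n²·(dirR f + d·m_G²·Σ|f|²)` (`∂_ν = n(S_ν − 1)`). [folklore] -/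
theorem sum_inBlock_nsq_sdiff_frame_le {R : Tor (fine n M) → Fin d → ℂ} {G : Tor (fine n M) → ℂ} (hG : ∀ x, ‖G x‖ = 1) {mG : ℝ}
    (hframe : ∀ (y : Tor M) (j : Fin d → Fin n) (μ : Fin d), (j μ : ℕ) + 1 < n →
      ‖G (bpt n M y j + unitVec (fine n M) μ) - G (bpt n M y j) * R (bpt n M y j) μ‖ ≤ mG)
    (f : Tor (fine n M) → ℂ) :
    ∑ ν : Fin d, ∑ y : Tor M, ∑ j ∈ univ.filter (fun j : Fin d → Fin n => (j ν : ℕ) + 1 < n),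
        ‖(sdiff (fine n M) (n : ℂ) ν *ᵥ fun x => G x * f x) (bpt n M y j)‖ ^ 2
      ≤ 2 * (n : ℝ) ^ 2 * (dirR n M R f + d * mG ^ 2 * nsq f) := by
  -- per direction: enlarge to all base points with the non-negative majorant, then un-chart and translate
  have per : ∀ ν : Fin d, ∑ y : Tor M, ∑ j ∈ univ.filter (fun j : Fin d → Fin n => (j ν : ℕ) + 1 < n),
        ‖(sdiff (fine n M) (n : ℂ) ν *ᵥ fun x => G x * f x) (bpt n M y j)‖ ^ 2
      ≤ (n : ℝ) ^ 2 * (2 * (mG ^ 2 * nsq f) + 2 * ∑ x, ‖R x ν * f (x + unitVec (fine n M) ν) - f x‖ ^ 2) := by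
    intro ν
    set maj : Tor (fine n M) → ℝ := fun x => (n : ℝ) ^ 2 * (2 * (mG ^ 2 * ‖f (x + unitVec (fine n M) ν)‖ ^ 2)
      + 2 * ‖R x ν * f (x + unitVec (fine n M) ν) - f x‖ ^ 2) with hmaj
    have hmaj0 : ∀ x, 0 ≤ maj x := fun x => by positivity
    have step1 : ∀ y : Tor M, ∑ j ∈ univ.filter (fun j : Fin d → Fin n => (j ν : ℕ) + 1 < n),
          ‖(sdiff (fine n M) (n : ℂ) ν *ᵥ fun x => G x * f x) (bpt n M y j)‖ ^ 2
        ≤ ∑ j : Fin d → Fin n, maj (bpt n M y j) := by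
      intro y
      refine (sum_le_sum fun j hj => ?_).trans (sum_le_sum_of_subset_of_nonneg (filter_subset _ _) fun j _ _ => hmaj0 _)
      have hj' : (j ν : ℕ) + 1 < n := (mem_filter.mp hj).2
      rw [sdiff_mulVec, norm_mul, mul_pow, Complex.norm_natCast, hmaj]
      exact mul_le_mul_of_nonneg_left (norm_frame_diff_sq_le n M hG f (hframe y j ν hj')) (by positivity)
    refine (sum_le_sum fun y _ => step1 y).trans (le_of_eq ?_)
    rw [← sum_blocks_real n M maj, hmaj]
    simp only []
    rw [← mul_sum, sum_add_distrib, ← mul_sum, ← mul_sum, ← mul_sum,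
      sum_translate n M (fun x => ‖f x‖ ^ 2) (unitVec (fine n M) ν)]
    rfl
  refine (sum_le_sum fun ν _ => per ν).trans (le_of_eq ?_)
  rw [← mul_sum, sum_add_distrib, sum_const, Finset.card_univ, Fintype.card_fin, nsmul_eq_mul, ← mul_sum]
  unfold dirR
  ring

/-! ## §2 Leaf P⁺ with the frame hypothesis on in-block bonds only -/

omit [NeZero L] in
/-- **LEAF P⁺ LOCALISED (lattice units)**: `Σ_x |f x|² ≤ 8·n^d·Σ_z |(Q_T f)(z)|² + 4·n²·Σ_{μ,x} |R(x,μ)f(x+e_μ) − f(x)|²` for a unitary frame `G`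
whose bond defect `m_G` is controlled on the IN-BLOCK bonds only, block phases `c` (`|c| ≤ 1`) with `|G − c·T| ≤ m_B` on sites, and the PER-BLOCK
smallness `2d·(n·m_G)² + 4·m_B² ≤ ½`.  (Owner's `nsq_le_covariant_poincare` with `ScalarBlockPoincareLocal.nsq_sub_PiS_le_inBlock` in place of
`ScalarBlockPoincare.nsq_sub_PiS_le`: `C_P = 4` instead of `32d`, no bond outside a block is ever charged.) [folklore] -/
theorem nsq_le_covariant_poincare_local {R : Tor (fine n M) → Fin d → ℂ} {T G : Tor (fine n M) → ℂ} {c : Tor M → ℂ}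
    (hG : ∀ x, ‖G x‖ = 1) (hc : ∀ z, ‖c z‖ ≤ 1) {mG mB : ℝ}
    (hframe : ∀ (y : Tor M) (j : Fin d → Fin n) (μ : Fin d), (j μ : ℕ) + 1 < n →
      ‖G (bpt n M y j + unitVec (fine n M) μ) - G (bpt n M y j) * R (bpt n M y j) μ‖ ≤ mG)
    (hblock : ∀ z j, ‖G (bpt n M z j) - c z * T (bpt n M z j)‖ ≤ mB)
    (hsmall : 2 * (d : ℝ) * ((n : ℝ) * mG) ^ 2 + 4 * mB ^ 2 ≤ 1 / 2) (f : Tor (fine n M) → ℂ) :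
    nsq f ≤ 8 * (n : ℝ) ^ d * ∑ z, ‖QT n M T f z‖ ^ 2 + 4 * (n : ℝ) ^ 2 * dirR n M R f := by
  set g : Tor (fine n M) → ℂ := fun x => G x * f x with hg
  have hgf : nsq g = nsq f := nsq_frame_mul n M hG f
  have hsplit : nsq g ≤ 2 * nsq (g - PiS n M *ᵥ g) + 2 * nsq (PiS n M *ᵥ g) := by
    have h := nsq_add_le (g - PiS n M *ᵥ g) (PiS n M *ᵥ g)
    rwa [sub_add_cancel] at h
  have hP := nsq_sub_PiS_le_inBlock n M g
  have h1 := sum_inBlock_nsq_sdiff_frame_le n M hG hframe f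
  have h2 := nsq_PiS_frame_le n M hc hblock f
  have hD : 0 ≤ dirR n M R f := sum_nonneg fun _ _ => sum_nonneg fun _ _ => by positivity
  have hQ : 0 ≤ ∑ z, ‖QT n M T f z‖ ^ 2 := sum_nonneg fun _ _ => by positivity
  rw [← hg] at h1 h2
  rw [← hgf] at h1 h2 ⊢
  set S := ∑ ν : Fin d, ∑ y : Tor M, ∑ j ∈ univ.filter (fun j : Fin d → Fin n => (j ν : ℕ) + 1 < n),
      ‖(sdiff (fine n M) (n : ℂ) ν *ᵥ g) (bpt n M y j)‖ ^ 2 with hS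
  set D := dirR n M R f with hDdef
  set Q := ∑ z, ‖QT n M T f z‖ ^ 2 with hQdef
  have hg0 : 0 ≤ nsq g := nsq_nonneg g
  have s1 : nsq g ≤ 2 * (1 / 2 * S) + 2 * (2 * (n : ℝ) ^ d * Q + 2 * mB ^ 2 * nsq g) :=
    hsplit.trans (add_le_add (mul_le_mul_of_nonneg_left hP (by norm_num)) (mul_le_mul_of_nonneg_left h2 (by norm_num)))
  have key : nsq g ≤ 2 * (n : ℝ) ^ 2 * D + 4 * (n : ℝ) ^ d * Q
      + (2 * (d : ℝ) * ((n : ℝ) * mG) ^ 2 + 4 * mB ^ 2) * nsq g := by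
    have e : (2 * (d : ℝ) * ((n : ℝ) * mG) ^ 2 + 4 * mB ^ 2) * nsq g
        = 2 * (n : ℝ) ^ 2 * (d * mG ^ 2 * nsq g) + 4 * mB ^ 2 * nsq g := by ring
    rw [e]
    nlinarith [s1, h1]
  nlinarith [key, mul_le_mul_of_nonneg_right hsmall hg0]

/-! ## §3 (O6)(c): the frames are constructible from the data — no frame, no global small field -/

omit [NeZero n] [NeZero L] hM in
/-- for a UNIT site transport the frame defect of `G := T` IS the in-block transport defect: `‖T(x′) − T(x)·R‖ = ‖R·conj T(x′)·T(x) − 1‖`. [folklore] -/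
theorem norm_transport_frame_eq {T : Tor (fine n M) → ℂ} (hT : ∀ x, ‖T x‖ = 1) (R : ℂ) (x x' : Tor (fine n M)) :
    ‖T x' - T x * R‖ = ‖R * conj (T x') * T x - 1‖ := by
  have hu : conj (T x') * T x' = 1 := by
    rw [Complex.conj_mul', hT]; norm_num
  have e : R * conj (T x') * T x - 1 = -(conj (T x') * (T x' - T x * R)) := by
    rw [mul_sub, ← mul_assoc, hu]; ring
  rw [e, norm_neg, norm_mul, Complex.norm_conj, hT, one_mul]

omit [NeZero L] in
/-- **LEAF P⁺ WITHOUT FRAMES** ((O6)(c)): for UNIT site transports `T` and bond phases `R` whose IN-BLOCK transport defect is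
`|R(x,μ)·conj T(x+e_μ)·T(x) − 1| ≤ w` on every bond with both ends in one block (leaf UB⁺'s binder `hw`), and `2d·(n·w)² ≤ ½`:
`Σ_x |f x|² ≤ 8·n^d·Σ_z |(Q_T f)(z)|² + 4·n²·dirR f`.  Frame `G := T`, block phases `c := 1`, `m_B := 0`. [folklore] -/
theorem nsq_le_covariant_poincare_of_inBlock {R : Tor (fine n M) → Fin d → ℂ} {T : Tor (fine n M) → ℂ} (hT : ∀ x, ‖T x‖ = 1) {w : ℝ}
    (hw : ∀ (y : Tor M) (j : Fin d → Fin n) (μ : Fin d), (j μ : ℕ) + 1 < n →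
      ‖R (bpt n M y j) μ * conj (T (bpt n M y j + unitVec (fine n M) μ)) * T (bpt n M y j) - 1‖ ≤ w)
    (hsmall : 2 * (d : ℝ) * ((n : ℝ) * w) ^ 2 ≤ 1 / 2) (f : Tor (fine n M) → ℂ) :
    nsq f ≤ 8 * (n : ℝ) ^ d * ∑ z, ‖QT n M T f z‖ ^ 2 + 4 * (n : ℝ) ^ 2 * dirR n M R f := by
  refine nsq_le_covariant_poincare_local n M (G := T) (c := fun _ => 1) (mG := w) (mB := 0) hT (fun _ => by rw [norm_one])
    (fun y j μ h => ?_) (fun z j => by rw [one_mul, sub_self, norm_zero]) (by simpa using hsmall) f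
  rw [norm_transport_frame_eq n M hT]
  exact hw y j μ h

omit [NeZero L] in
/-- the same with the in-block hypothesis phrased by blocks (`blockOf (x + e_μ) = blockOf x`; cf. `VariationalCovariantUpperBound.inBlock_of_blockOf`).
[folklore] -/
theorem nsq_le_covariant_poincare_of_blockOf {R : Tor (fine n M) → Fin d → ℂ} {T : Tor (fine n M) → ℂ} (hT : ∀ x, ‖T x‖ = 1) {w : ℝ}
    (hw' : ∀ (x : Tor (fine n M)) (μ : Fin d), blockOf n M (x + unitVec (fine n M) μ) = blockOf n M x →
      ‖R x μ * conj (T (x + unitVec (fine n M) μ)) * T x - 1‖ ≤ w)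
    (hsmall : 2 * (d : ℝ) * ((n : ℝ) * w) ^ 2 ≤ 1 / 2) (f : Tor (fine n M) → ℂ) :
    nsq f ≤ 8 * (n : ℝ) ^ d * ∑ z, ‖QT n M T f z‖ ^ 2 + 4 * (n : ℝ) ^ 2 * dirR n M R f :=
  nsq_le_covariant_poincare_of_inBlock n M hT (fun y j μ h => hw' _ μ (blockOf_bpt_add_unitVec n M y j μ h)) hsmall f

/-! ## §3b Relative form: a nested transport `T` read against a REFERENCE transport `T₀` (the owner's R-line, N-ne2p2g11-2) -/

omit [NeZero n] [NeZero L] hM in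
/-- for UNIT `T, T₀`: `‖T₀ x − 1·T x‖ = ‖T x·conj (T₀ x) − 1‖` (the relative phase). [folklore] -/
theorem norm_ref_sub_eq {T T₀ : Tor (fine n M) → ℂ} (hT₀ : ∀ x, ‖T₀ x‖ = 1) (x : Tor (fine n M)) :
    ‖T₀ x - 1 * T x‖ = ‖T x * conj (T₀ x) - 1‖ := by
  have hu : conj (T₀ x) * T₀ x = 1 := by
    rw [Complex.conj_mul', hT₀]; norm_num
  have e : T x * conj (T₀ x) - 1 = -(conj (T₀ x) * (T₀ x - 1 * T x)) := by linear_combination hu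
  rw [e, norm_neg, norm_mul, Complex.norm_conj, hT₀]
  simp

omit [NeZero L] in
/-- **LEAF P⁺ RELATIVE TO A REFERENCE TRANSPORT** (for the owner's repair line N-ne2p2g11-2 ∕ (R1)–(R3)): the averaging uses ANY unit transport `T`
(e.g. Bałaban's NESTED composite, whose own in-block defect is NOT small), the coercivity is read through a REFERENCE unit transport `T₀` (e.g. the
straight taxi) with SMALL in-block defect `|R(x,μ)·conj T₀(x+e_μ)·T₀(x) − 1| ≤ w₀` on in-block bonds and relative phase `|T(x)·conj T₀(x) − 1| ≤ γ`:
`Σ|f|² ≤ 8·n^d·Σ_z|(Q_T f)(z)|² + 4·n²·dirR f` provided `2d·(n·w₀)² + 4γ² ≤ ½`.  Frame `G := T₀`, `c := 1`, `m_G := w₀`, `m_B := γ`. [folklore] -/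
theorem nsq_le_covariant_poincare_rel {R : Tor (fine n M) → Fin d → ℂ} {T T₀ : Tor (fine n M) → ℂ} (hT₀ : ∀ x, ‖T₀ x‖ = 1) {w₀ γ : ℝ}
    (hw₀ : ∀ (y : Tor M) (j : Fin d → Fin n) (μ : Fin d), (j μ : ℕ) + 1 < n →
      ‖R (bpt n M y j) μ * conj (T₀ (bpt n M y j + unitVec (fine n M) μ)) * T₀ (bpt n M y j) - 1‖ ≤ w₀)
    (hrel : ∀ x, ‖T x * conj (T₀ x) - 1‖ ≤ γ)
    (hsmall : 2 * (d : ℝ) * ((n : ℝ) * w₀) ^ 2 + 4 * γ ^ 2 ≤ 1 / 2) (f : Tor (fine n M) → ℂ) :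
    nsq f ≤ 8 * (n : ℝ) ^ d * ∑ z, ‖QT n M T f z‖ ^ 2 + 4 * (n : ℝ) ^ 2 * dirR n M R f := by
  refine nsq_le_covariant_poincare_local n M (G := T₀) (c := fun _ => 1) (mG := w₀) (mB := γ) hT₀ (fun _ => by rw [norm_one])
    (fun y j μ h => ?_) (fun z j => ?_) hsmall f
  · rw [norm_transport_frame_eq n M hT₀]
    exact hw₀ y j μ h
  · rw [norm_ref_sub_eq n M hT₀]
    exact hrel _

/-! ## §4 Physical units: the `hPc` ∕ `hPf` inputs of the canonical pair, frame-free -/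

omit [NeZero L] in
/-- **P⁺ at level `n`, frame-free**: `qW f ≤ 8·nsq (Q_T f) + 4·Sc f ≤ 136·(Sc f + nsq (Q_T f))` under unit transports, the in-block defect `w` and
`2d·(n·w)² ≤ ½`. [folklore] -/
theorem qW_le_coarse_local {Rc : Tor (fine n M) → Fin d → ℂ} {T : Tor (fine n M) → ℂ} (hT : ∀ x, ‖T x‖ = 1) {w : ℝ}
    (hw : ∀ (y : Tor M) (j : Fin d → Fin n) (μ : Fin d), (j μ : ℕ) + 1 < n →
      ‖Rc (bpt n M y j) μ * conj (T (bpt n M y j + unitVec (fine n M) μ)) * T (bpt n M y j) - 1‖ ≤ w)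
    (hsmall : 2 * (d : ℝ) * ((n : ℝ) * w) ^ 2 ≤ 1 / 2) (f : Tor (fine n M) → ℂ) :
    qW n M f ≤ 136 * (Sc n M Rc f + nsq (Qk n M T f)) := by
  have hn : (0 : ℝ) < (n : ℝ) ^ d := by have := NeZero.ne n; positivity
  set Z : ℝ := nsq (Qk n M T f) with hZ
  set D : ℝ := ∑ μ, dirU (fine n M) Rc f μ with hD
  have hP : nsq f ≤ 8 * (n : ℝ) ^ d * Z + 4 * (n : ℝ) ^ 2 * D :=
    nsq_le_covariant_poincare_of_inBlock n M (R := Rc) (T := T) hT hw hsmall f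
  have hD0 : 0 ≤ D := sum_nonneg fun μ _ => dirU_nonneg _ _ _ _
  have hZ0 : 0 ≤ Z := nsq_nonneg _
  have hSc : Sc n M Rc f = (n : ℝ) ^ 2 / (n : ℝ) ^ d * D := rfl
  have h1 : qW n M f ≤ 8 * Z + 4 * Sc n M Rc f := by
    unfold qW
    rw [hSc]
    have e : ((n : ℝ) ^ d)⁻¹ * (8 * (n : ℝ) ^ d * Z + 4 * (n : ℝ) ^ 2 * D) = 8 * Z + 4 * ((n : ℝ) ^ 2 / (n : ℝ) ^ d * D) := by
      field_simp
    rw [← e]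
    exact mul_le_mul_of_nonneg_left hP (by positivity)
  have hSc0 : 0 ≤ Sc n M Rc f := Sc_nonneg n M Rc f
  linarith

omit [NeZero L] in
/-- **P⁺ at level `n`, relative form** (reference transport `T₀`, relative phase `γ`): `qW f ≤ 136·(Sc f + nsq (Q_T f))` under `2d·(n·w₀)² + 4γ² ≤ ½`.
[folklore] -/
theorem qW_le_coarse_rel {Rc : Tor (fine n M) → Fin d → ℂ} {T T₀ : Tor (fine n M) → ℂ} (hT₀ : ∀ x, ‖T₀ x‖ = 1) {w₀ γ : ℝ}
    (hw₀ : ∀ (y : Tor M) (j : Fin d → Fin n) (μ : Fin d), (j μ : ℕ) + 1 < n →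
      ‖Rc (bpt n M y j) μ * conj (T₀ (bpt n M y j + unitVec (fine n M) μ)) * T₀ (bpt n M y j) - 1‖ ≤ w₀)
    (hrel : ∀ x, ‖T x * conj (T₀ x) - 1‖ ≤ γ)
    (hsmall : 2 * (d : ℝ) * ((n : ℝ) * w₀) ^ 2 + 4 * γ ^ 2 ≤ 1 / 2) (f : Tor (fine n M) → ℂ) :
    qW n M f ≤ 136 * (Sc n M Rc f + nsq (Qk n M T f)) := by
  have hn : (0 : ℝ) < (n : ℝ) ^ d := by have := NeZero.ne n; positivity
  set Z : ℝ := nsq (Qk n M T f) with hZ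
  set D : ℝ := ∑ μ, dirU (fine n M) Rc f μ with hD
  have hP : nsq f ≤ 8 * (n : ℝ) ^ d * Z + 4 * (n : ℝ) ^ 2 * D :=
    nsq_le_covariant_poincare_rel n M (R := Rc) (T := T) hT₀ hw₀ hrel hsmall f
  have hD0 : 0 ≤ D := sum_nonneg fun μ _ => dirU_nonneg _ _ _ _
  have hZ0 : 0 ≤ Z := nsq_nonneg _
  have hSc : Sc n M Rc f = (n : ℝ) ^ 2 / (n : ℝ) ^ d * D := rfl
  have h1 : qW n M f ≤ 8 * Z + 4 * Sc n M Rc f := by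
    unfold qW
    rw [hSc]
    have e : ((n : ℝ) ^ d)⁻¹ * (8 * (n : ℝ) ^ d * Z + 4 * (n : ℝ) ^ 2 * D) = 8 * Z + 4 * ((n : ℝ) ^ 2 / (n : ℝ) ^ d * D) := by
      field_simp
    rw [← e]
    exact mul_le_mul_of_nonneg_left hP (by positivity)
  have hSc0 : 0 ≤ Sc n M Rc f := Sc_nonneg n M Rc f
  linarith

/-- **P⁺ for the COMPOSITE constraint at level `nL` from the two lattice-unit coercivities as HYPOTHESES** (level `n` with constants `8, 4` for the
pair `(Rc, T)`; one step, blocks of side `L` over the level-`n` torus, for `(R′, T′)`) + FED⁺ (`sum_dirU_Qc_le` BY NAME, mismatch `m`):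
`qV f′ ≤ 136·(Sf f′ + nsq (Q_T (Q_{T′} f′)))` provided `64d·(n·m)² ≤ ½`.  The local ∕ relative corollaries below discharge the two hypotheses. [folklore] -/
theorem qV_le_composite_of_poincare {Rc : Tor (fine n M) → Fin d → ℂ} {R' : Tor (fine L (fine n M)) → Fin d → ℂ}
    {T : Tor (fine n M) → ℂ} {T' : Tor (fine L (fine n M)) → ℂ}
    (hPn : ∀ g : Tor (fine n M) → ℂ, nsq g ≤ 8 * (n : ℝ) ^ d * ∑ z, ‖QT n M T g z‖ ^ 2 + 4 * (n : ℝ) ^ 2 * dirR n M Rc g)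
    (hPL : ∀ g' : Tor (fine L (fine n M)) → ℂ,
      nsq g' ≤ 8 * (L : ℝ) ^ d * ∑ y, ‖QT L (fine n M) T' g' y‖ ^ 2 + 4 * (L : ℝ) ^ 2 * dirR L (fine n M) R' g')
    (hR' : ∀ x μ, ‖R' x μ‖ ≤ 1) (hT' : ∀ x, ‖T' x‖ ≤ 1) {m : ℝ} (hm : 0 ≤ m)
    (hmis : ∀ y μ j, ‖mis L (fine n M) Rc R' T' y μ j‖ ≤ m) (habsorb : 64 * (d : ℝ) * ((n : ℝ) * m) ^ 2 ≤ 1 / 2)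
    (f' : Tor (fine L (fine n M)) → ℂ) :
    qV n L M f' ≤ 136 * (Sf n L M R' f' + nsq (Qk n M T (Q1 n L M T' f'))) := by
  have hn1 : (1 : ℝ) ≤ n := by exact_mod_cast Nat.one_le_iff_ne_zero.mpr (NeZero.ne n)
  have hn0 : (0 : ℝ) < n := by exact_mod_cast Nat.pos_of_ne_zero (NeZero.ne n)
  have hL0 : (0 : ℝ) < L := by exact_mod_cast Nat.pos_of_ne_zero (NeZero.ne L)
  have hLd : (0 : ℝ) < (L : ℝ) ^ d := pow_pos hL0 d
  have hnLd : (0 : ℝ) < ((n : ℝ) * L) ^ d := pow_pos (mul_pos hn0 hL0) d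
  have hd : (0 : ℝ) ≤ d := Nat.cast_nonneg d
  set lam : Tor (fine n M) → ℂ := Q1 n L M T' f' with hlam
  set Y : ℝ := nsq f' with hY
  set DX : ℝ := ∑ μ, dirU (fine L (fine n M)) R' f' μ with hDX
  set P : ℝ := nsq lam with hPdef
  set Z : ℝ := nsq (Qk n M T lam) with hZ
  set E : ℝ := ∑ μ, dirU (fine n M) Rc lam μ with hE
  have hY0 : 0 ≤ Y := nsq_nonneg _
  have hDX0 : 0 ≤ DX := sum_nonneg fun μ _ => dirU_nonneg _ _ _ _
  have hZ0 : 0 ≤ Z := nsq_nonneg _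
  have hE0 : 0 ≤ E := sum_nonneg fun μ _ => dirU_nonneg _ _ _ _
  have s1 : Y ≤ 8 * (L : ℝ) ^ d * P + 4 * (L : ℝ) ^ 2 * DX := hPL f'
  have s2 : P ≤ 8 * (n : ℝ) ^ d * Z + 4 * (n : ℝ) ^ 2 * E := hPn lam
  -- FED⁺ bounds the coarse Dirichlet sum of the average (verbatim from the owner's `qV_le_composite`)
  have s3 : (L : ℝ) ^ d * E ≤ 2 * (L : ℝ) ^ 2 * DX + 2 * d * m ^ 2 * Y := by
    have h : E ≤ (Real.sqrt ((L : ℝ) ^ 2 * DX / (L : ℝ) ^ d) + Real.sqrt d * (m * Real.sqrt (Y / (L : ℝ) ^ d))) ^ 2 :=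
      sum_dirU_Qc_le L (fine n M) Rc R' T' hR' hT' hm hmis f'
    have ha : 0 ≤ (L : ℝ) ^ 2 * DX / (L : ℝ) ^ d := div_nonneg (mul_nonneg (sq_nonneg _) hDX0) hLd.le
    have hb : 0 ≤ Y / (L : ℝ) ^ d := div_nonneg hY0 hLd.le
    set A : ℝ := Real.sqrt ((L : ℝ) ^ 2 * DX / (L : ℝ) ^ d) with hA
    set B : ℝ := Real.sqrt d * (m * Real.sqrt (Y / (L : ℝ) ^ d)) with hB
    have hA2 : A ^ 2 = (L : ℝ) ^ 2 * DX / (L : ℝ) ^ d := Real.sq_sqrt ha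
    have hB2 : B ^ 2 = d * (m ^ 2 * (Y / (L : ℝ) ^ d)) := by
      rw [hB, mul_pow, mul_pow, Real.sq_sqrt hd, Real.sq_sqrt hb]
    have h3 : E ≤ 2 * ((L : ℝ) ^ 2 * DX / (L : ℝ) ^ d) + 2 * (d * (m ^ 2 * (Y / (L : ℝ) ^ d))) := by
      rw [← hA2, ← hB2]
      have hab : (A + B) ^ 2 ≤ 2 * A ^ 2 + 2 * B ^ 2 := by nlinarith [sq_nonneg (A - B)]
      exact h.trans hab
    have h4 := mul_le_mul_of_nonneg_left h3 hLd.le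
    have e : (L : ℝ) ^ d * (2 * ((L : ℝ) ^ 2 * DX / (L : ℝ) ^ d) + 2 * (d * (m ^ 2 * (Y / (L : ℝ) ^ d))))
        = 2 * (L : ℝ) ^ 2 * DX + 2 * d * m ^ 2 * Y := by field_simp
    rwa [e] at h4
  have t1 : 8 * (L : ℝ) ^ d * P ≤ 8 * (L : ℝ) ^ d * (8 * (n : ℝ) ^ d * Z + 4 * (n : ℝ) ^ 2 * E) :=
    mul_le_mul_of_nonneg_left s2 (by positivity)
  have t3 : 32 * (n : ℝ) ^ 2 * ((L : ℝ) ^ d * E) ≤ 32 * (n : ℝ) ^ 2 * (2 * (L : ℝ) ^ 2 * DX + 2 * d * m ^ 2 * Y) :=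
    mul_le_mul_of_nonneg_left s3 (by positivity)
  have comb : Y ≤ 64 * ((n : ℝ) ^ d * (L : ℝ) ^ d) * Z + (64 * (n : ℝ) ^ 2 * (L : ℝ) ^ 2 + 4 * (L : ℝ) ^ 2) * DX
      + 64 * (d : ℝ) * ((n : ℝ) * m) ^ 2 * Y := by
    nlinarith [s1, t1, t3]
  have hpow : (n : ℝ) ^ d * (L : ℝ) ^ d = ((n : ℝ) * L) ^ d := by rw [mul_pow]
  rw [hpow] at comb
  have t4 : 64 * (d : ℝ) * ((n : ℝ) * m) ^ 2 * Y ≤ 1 / 2 * Y := mul_le_mul_of_nonneg_right habsorb hY0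
  have hL2 : (L : ℝ) ^ 2 * DX ≤ ((n : ℝ) * L) ^ 2 * DX := by
    refine mul_le_mul_of_nonneg_right ?_ hDX0
    rw [mul_pow]
    calc (L : ℝ) ^ 2 = 1 * (L : ℝ) ^ 2 := (one_mul _).symm
      _ ≤ (n : ℝ) ^ 2 * (L : ℝ) ^ 2 := mul_le_mul_of_nonneg_right (one_le_pow₀ hn1) (sq_nonneg _)
  have hY : Y ≤ 128 * ((n : ℝ) * L) ^ d * Z + 136 * (((n : ℝ) * L) ^ 2 * DX) := by
    have e3 : (64 * (n : ℝ) ^ 2 * (L : ℝ) ^ 2 + 4 * (L : ℝ) ^ 2) * DX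
        = 64 * (((n : ℝ) * L) ^ 2 * DX) + 4 * ((L : ℝ) ^ 2 * DX) := by ring
    rw [e3] at comb
    linarith [comb, t4, hL2]
  have hSf : Sf n L M R' f' = ((n : ℝ) * L) ^ 2 / ((n : ℝ) * L) ^ d * DX := rfl
  have hqV : qV n L M f' = (((n : ℝ) * L) ^ d)⁻¹ * Y := rfl
  rw [hqV, hSf]
  have h5 : (((n : ℝ) * L) ^ d)⁻¹ * Y ≤ 128 * Z + 136 * (((n : ℝ) * L) ^ 2 / ((n : ℝ) * L) ^ d * DX) := by
    have e : (((n : ℝ) * L) ^ d)⁻¹ * (128 * ((n : ℝ) * L) ^ d * Z + 136 * (((n : ℝ) * L) ^ 2 * DX))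
        = 128 * Z + 136 * (((n : ℝ) * L) ^ 2 / ((n : ℝ) * L) ^ d * DX) := by
      field_simp
    rw [← e]
    exact mul_le_mul_of_nonneg_left hY (by positivity)
  have hS0 : 0 ≤ ((n : ℝ) * L) ^ 2 / ((n : ℝ) * L) ^ d * DX := mul_nonneg (div_nonneg (sq_nonneg _) hnLd.le) hDX0
  linarith [h5, hS0, hZ0]

/-- **P⁺ for the COMPOSITE constraint at level `nL`, frame-free** = one-step local P⁺ (blocks of side `L`, unit `T′`, in-block defect `w′`) +
level-`n` local P⁺ (unit `T`, in-block defect `w`) + FED⁺: `qV f′ ≤ 136·(Sf f′ + nsq (Q_T (Q_{T′} f′)))`, provided `2d(n·w)² ≤ ½`, `2d(L·w′)² ≤ ½`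
and `64d·(n·m)² ≤ ½`. [folklore] -/
theorem qV_le_composite_local {Rc : Tor (fine n M) → Fin d → ℂ} {R' : Tor (fine L (fine n M)) → Fin d → ℂ}
    {T : Tor (fine n M) → ℂ} {T' : Tor (fine L (fine n M)) → ℂ} (hT : ∀ x, ‖T x‖ = 1) {w : ℝ}
    (hw : ∀ (y : Tor M) (j : Fin d → Fin n) (μ : Fin d), (j μ : ℕ) + 1 < n →
      ‖Rc (bpt n M y j) μ * conj (T (bpt n M y j + unitVec (fine n M) μ)) * T (bpt n M y j) - 1‖ ≤ w)
    (hsmall : 2 * (d : ℝ) * ((n : ℝ) * w) ^ 2 ≤ 1 / 2)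
    (hT' : ∀ x, ‖T' x‖ = 1) {w' : ℝ}
    (hw' : ∀ (y : Tor (fine n M)) (j : Fin d → Fin L) (μ : Fin d), (j μ : ℕ) + 1 < L →
      ‖R' (bpt L (fine n M) y j) μ * conj (T' (bpt L (fine n M) y j + unitVec (fine L (fine n M)) μ)) * T' (bpt L (fine n M) y j) - 1‖ ≤ w')
    (hsmall' : 2 * (d : ℝ) * ((L : ℝ) * w') ^ 2 ≤ 1 / 2)
    (hR' : ∀ x μ, ‖R' x μ‖ ≤ 1) {m : ℝ} (hm : 0 ≤ m)
    (hmis : ∀ y μ j, ‖mis L (fine n M) Rc R' T' y μ j‖ ≤ m) (habsorb : 64 * (d : ℝ) * ((n : ℝ) * m) ^ 2 ≤ 1 / 2)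
    (f' : Tor (fine L (fine n M)) → ℂ) :
    qV n L M f' ≤ 136 * (Sf n L M R' f' + nsq (Qk n M T (Q1 n L M T' f'))) :=
  qV_le_composite_of_poincare n L M (nsq_le_covariant_poincare_of_inBlock n M hT hw hsmall)
    (nsq_le_covariant_poincare_of_inBlock L (fine n M) hT' hw' hsmall') hR' (fun x => (hT' x).le) hm hmis habsorb f'

/-- **P⁺ for the COMPOSITE constraint, relative form at the coarse level**: the level-`n` transport `T` (e.g. the nested composite) is read
against a reference unit transport `T₀` (in-block defect `w₀`, relative phase `γ`, `2d(n·w₀)² + 4γ² ≤ ½`); the one-step level is frame-free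
(unit `T′`, in-block defect `w′`, `2d(L·w′)² ≤ ½`). [folklore] -/
theorem qV_le_composite_rel {Rc : Tor (fine n M) → Fin d → ℂ} {R' : Tor (fine L (fine n M)) → Fin d → ℂ}
    {T T₀ : Tor (fine n M) → ℂ} {T' : Tor (fine L (fine n M)) → ℂ} (hT₀ : ∀ x, ‖T₀ x‖ = 1) {w₀ γ : ℝ}
    (hw₀ : ∀ (y : Tor M) (j : Fin d → Fin n) (μ : Fin d), (j μ : ℕ) + 1 < n →
      ‖Rc (bpt n M y j) μ * conj (T₀ (bpt n M y j + unitVec (fine n M) μ)) * T₀ (bpt n M y j) - 1‖ ≤ w₀)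
    (hrel : ∀ x, ‖T x * conj (T₀ x) - 1‖ ≤ γ)
    (hsmall : 2 * (d : ℝ) * ((n : ℝ) * w₀) ^ 2 + 4 * γ ^ 2 ≤ 1 / 2)
    (hT' : ∀ x, ‖T' x‖ = 1) {w' : ℝ}
    (hw' : ∀ (y : Tor (fine n M)) (j : Fin d → Fin L) (μ : Fin d), (j μ : ℕ) + 1 < L →
      ‖R' (bpt L (fine n M) y j) μ * conj (T' (bpt L (fine n M) y j + unitVec (fine L (fine n M)) μ)) * T' (bpt L (fine n M) y j) - 1‖ ≤ w')
    (hsmall' : 2 * (d : ℝ) * ((L : ℝ) * w') ^ 2 ≤ 1 / 2)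
    (hR' : ∀ x μ, ‖R' x μ‖ ≤ 1) {m : ℝ} (hm : 0 ≤ m)
    (hmis : ∀ y μ j, ‖mis L (fine n M) Rc R' T' y μ j‖ ≤ m) (habsorb : 64 * (d : ℝ) * ((n : ℝ) * m) ^ 2 ≤ 1 / 2)
    (f' : Tor (fine L (fine n M)) → ℂ) :
    qV n L M f' ≤ 136 * (Sf n L M R' f' + nsq (Qk n M T (Q1 n L M T' f'))) :=
  qV_le_composite_of_poincare n L M (nsq_le_covariant_poincare_rel n M hT₀ hw₀ hrel hsmall)
    (nsq_le_covariant_poincare_of_inBlock L (fine n M) hT' hw' hsmall') hR' (fun x => (hT' x).le) hm hmis habsorb f'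
end Summit.QuantumFields.BalabanUV.T4Continuum.VariationalCovariantPoincareLocal

end
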